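import Literature.ModelTheory.ExponentialFields.Wilkie1996PolynomialBounds
import HarnessLib

/-!
# Wilkie's o-minimality theorem for `ℝ_exp`: decomposition into its two printed inputs

Topic `Literature/ModelTheory/ExponentialFields`.  The named fact
`Literature.ModelTheory.ExponentialFields.wilkie_isOMinimal` (`RealExpField.lean`; periods.S28:
the real exponential field `ℝ_exp = (ℝ; +, ·, -, 0, 1, exp, ≤)` is o-minimal, A. J. Wilkie,
J. Amer. Math. Soc. 9 (1996)) and its companion `wilkie_isModelComplete` (Wilkie's Second Main
Theorem) are proved in the tree (`Wilkie1996PolynomialBounds.lean`,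
`wilkie_isOMinimal_of_rexp_asymptotics` / `wilkie_isModelComplete_of_rexp_asymptotics`, on top of
`Wilkie1989*.lean`, `Wilkie1996*.lean`, `Khovanskii*.lean`, `RealExpOMinimal*.lean`) from exactly
the two published theorems that M. den Besten's complete write-up (*Wilkie's Theorem and the
Uniform Real Schanuel Conjecture*, Utrecht 2016) imports without proof:

1. `Wilkie1996_firstMainTheorem_rexp` — **Wilkie's First Main Theorem for the Pfaffian chain
   `exp↾[0,1]`**: the complete theory `T_{exp↾} = Th(ℝ; +, ·, -, 0, 1, exp↾[0,1], ≤)` is model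
   complete (Wilkie 1996, First Main Theorem, p. 1051, with Example (A), p. 1053; den Besten 2016,
   Theorem 2.1.1);
2. `vandenDries1986_powerAsymptotics_rexp` — **van den Dries' Puiseux-type asymptotics** for the
   unary functions definable in `(ℝ; +, ·, -, 0, 1, exp↾[0,1], ≤)`: such a function that is not
   eventually zero satisfies `f(x)·xˢ → a ≠ 0` (`x → +∞`) for some `s ∈ ℚ` (L. van den Dries,
   Bull. AMS 15 (1986), p. 192 "`f(t) ∼ c·tʳ`, `r` rational" for finitely subanalytic functions,
   of which the `ℝ_{exp↾}`-definable ones are a subclass; den Besten 2016, Proposition 4.1.6 (ii)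
   and Corollary 4.1.8).

The assemblies `wilkie_isOMinimal_holds_of` and `wilkie_isModelComplete_holds_of` are one-line
applications of the landed reductions.  Neither child restates a parent: (1) is about the
*restricted* exponential in the language `L_{exp↾}` (a different structure and theory), (2) is a
statement of real analysis about germs at `+∞` of `ℝ_{exp↾}`-definable functions.

## References

* A. J. Wilkie, *Model completeness results for expansions of the ordered field of real numbers by
  restricted Pfaffian functions and the exponential function*, J. Amer. Math. Soc. 9 (1996),
  1051–1094: First Main Theorem (p. 1051), Example (A) (p. 1053), Second Main Theorem. [WilkieJAMS1996]
* L. van den Dries, *A generalization of the Tarski–Seidenberg theorem, and some nondefinability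
  results*, Bull. Amer. Math. Soc. 15 (1986), 189–193: Theorem (p. 191), Polynomial growth (p. 192). [vandenDries1986]
* M. den Besten, *Wilkie's Theorem and the Uniform Real Schanuel Conjecture*, MSc thesis, Utrecht
  (2016): Theorem 2.1.1, Proposition 4.1.6, Corollaries 4.1.7–4.1.8, §6.2, §7.2. [DenBesten2016]
-/

noncomputable section

open Set Filter FirstOrder FirstOrder.Language
open scoped _root_.Topology

namespace Literature.ModelTheory.ExponentialFields

/-- **Wilkie's First Main Theorem for the restricted exponential** (A. J. Wilkie, J. Amer. Math.
Soc. 9 (1996), First Main Theorem, p. 1051, applied to the Pfaffian chain `exp↾[0,1]` of his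
Example (A), p. 1053; den Besten 2016, Theorem 2.1.1 "`T_{Pf↾}` is model complete" for the chain
`exp`): the complete theory `rexpTheory = T_{exp↾} = Th(ℝ; +, ·, -, 0, 1, exp↾[0,1], ≤)` of the real
ordered field with the restricted exponential (`exp↾[0,1](x) = eˣ` on `[0,1]`, `0` elsewhere;
`RestrictedExp.lean`) is model complete. [cite: WilkieJAMS1996, First Main Theorem (p. 1051) with Example (A) (p. 1053)] -/
def Wilkie1996_firstMainTheorem_rexp : Prop :=
  rexpTheory.IsModelComplete

/-- **Power asymptotics of `ℝ_{exp↾}`-definable unary functions** (L. van den Dries, Bull. Amer.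
Math. Soc. 15 (1986), p. 192, "Polynomial growth": a finitely subanalytic function `f` satisfies
"asymptotically, `f(t) ∼ c·tʳ` as `t → ∞`, for a real constant `c` and a rational constant `r`"
unless it vanishes identically for large `t`; den Besten 2016, Proposition 4.1.6 (ii) and
Corollary 4.1.8 for `L_{exp↾}`): every function `f : ℝ → ℝ` whose graph is definable with
parameters in `(ℝ; +, ·, -, 0, 1, exp↾[0,1], ≤)` and which is not eventually zero satisfies
`f(x)·xˢ → a` as `x → +∞` for some `s ∈ ℚ` and some real `a ≠ 0`. [cite: vandenDries1986, Polynomial growth (p. 192)] -/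
def vandenDries1986_powerAsymptotics_rexp : Prop :=
  ∀ f : ℝ → ℝ,
    (univ : Set ℝ).Definable Language.orderedRexpRing {v : Fin 2 → ℝ | v 1 = f (v 0)} →
    (∀ u : ℝ, ∃ x, u < x ∧ f x ≠ 0) →
      ∃ (s : ℚ) (a : ℝ), a ≠ 0 ∧ Tendsto (fun x => f x * x ^ (s : ℝ)) atTop (𝓝 a)

/-- **Assembly: o-minimality of `ℝ_exp` from its two printed inputs** — Wilkie's First Main
Theorem for `exp↾[0,1]` and van den Dries' power asymptotics — by
`wilkie_isOMinimal_of_rexp_asymptotics` (`Wilkie1996PolynomialBounds.lean`, resting on the landed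
formalisation of Wilkie 1996 §§9–11, Wilkie 1989 and Khovanskii's finiteness theorem).
[cite: WilkieJAMS1996, §1 and Second Main Theorem] -/
theorem wilkie_isOMinimal_holds_of :
    Wilkie1996_firstMainTheorem_rexp → vandenDries1986_powerAsymptotics_rexp → wilkie_isOMinimal :=
  fun hMC hP => wilkie_isOMinimal_of_rexp_asymptotics hMC hP

/-- **Assembly: Wilkie's Second Main Theorem (model completeness of `ℝ_exp`) from the same two
printed inputs**, by `wilkie_isModelComplete_of_rexp_asymptotics`. [cite: WilkieJAMS1996, Second Main Theorem and §§9–11] -/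
theorem wilkie_isModelComplete_holds_of :
    Wilkie1996_firstMainTheorem_rexp → vandenDries1986_powerAsymptotics_rexp →
      wilkie_isModelComplete :=
  fun hMC hP => wilkie_isModelComplete_of_rexp_asymptotics hMC hP

end Literature.ModelTheory.ExponentialFields
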